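import Literature.Probability.RandomPlanarGeometry.HullRestrictionSLELeaf
import Literature.Probability.RandomPlanarGeometry.RestrictionExponent
import Literature.Probability.RandomPlanarGeometry.RestrictionContinuityProofs
import HarnessLib

/-!
# `LawlerSchrammWerner2003` with [LSW] Prop. 3.3 discharged down to the density of `𝒜₀`

G. F. Lawler, O. Schramm, W. Werner, *Conformal restriction: the chordal case*, J. Amer. Math.
Soc. **16** (2003) 917–955, arXiv:math/0209343 (**[LSW]**, arXiv page numbers).

Proof-only bookkeeping file. `ConformalRestrictionLeaf.LawlerSchrammWerner2003_of_leaf_facts'''`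
reduces the named fact `Literature.Probability.RandomPlanarGeometry.LawlerSchrammWerner2003`
([LSW] p. 5 result 2, transposed; `ConformalRestriction`) to SEVEN named literature facts, one
of which is [LSW] Prop. 3.3 (1) ⇒ (3) (`exists_isRestrictionMeasure_of_isHullMultiplicative`).
`RestrictionExponent` proves that proposition from the two non-elementary clauses of [LSW]
Lemma 3.5, and `RestrictionContinuityProofs` proves one of them, the continuity of `F`
(`LSWConverges.tendsto_measure_avoid_holds`). Hence Prop. 3.3 now rests on a single named
fact, the density of `𝒜₀` in `𝒬₊` (`IsPlusHull.exists_isLSWGenerated_lswConverges`,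
`RestrictionDensity`: Loewner's slit theorem and the stability of the Loewner flow), and:

* `LawlerSchrammWerner2003_of_leaf_facts''''` — the target from SEVEN named facts: SLE₈ is
  generated by a curve (`hasSLETrace_eight`, Lawler–Schramm–Werner 2004 Thm. 4.7), SLE_κ for
  `κ ≠ 8` is (`hasSLETrace_of_ne_eight`, Rohde–Schramm 2005 Thm. 5.1), transience of the trace
  (`tendsto_norm_sleTrace_atTop`, RS05 Thm. 7.1), simplicity for `κ ≤ 4`
  (`ae_isSimpleTrace_sleTrace_of_le_four (κ = 8/3)`, RS05 Thm. 6.1), and from [LSW]: Thm. 6.1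
  (`sle_restriction_eightThirds`), the density clause of Lemma 3.5, and p. 5 result 2, first
  sentence = Thm. 7.3 / Cor. 8.6 (`IsRestrictionMeasure.eq_five_eighths_of_outer_simple`);
* `LawlerSchrammWerner2003_of_leaf_facts'''''` — the same with [LSW] Thm. 6.1
  (`sle_restriction_eightThirds`) replaced by the three leaf facts of ITS printed proof that
  remain named facts (`HullRestrictionSLELeaf`, `SLERestrictionSlidHull`): the restriction
  martingale `h_t'(W_t)^{5/8}` (`sle_exists_isRestrictionMartingale`, Prop. 5.2/5.3), Lemma 6.2
  (`Loewner.restrictionDeriv_exitTime_gt`) and Lemma 6.3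
  (`IsSmoothHull.restrictionDerivVanishesAtHit`). This is the current trust base of
  `LawlerSchrammWerner2003` inside [LSW]: Prop. 5.2/5.3, Lemmas 6.2, 6.3, the density clause of
  Lemma 3.5, and Thm. 7.3 / Cor. 8.6; outside [LSW]: the four Rohde–Schramm /
  Lawler–Schramm–Werner trace theorems.
-/

noncomputable section

open scoped NNReal

namespace Literature.Probability.RandomPlanarGeometry

/-- **[LSW] p. 5 result 2 (transposed) from the leaf facts, with Prop. 3.3 (1) ⇒ (3) replaced by
the density clause of Lemma 3.5** (`h35d`: `𝒜₀` is dense in `𝒬₊`); the continuity clause of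
Lemma 3.5 (`LSWConverges.tendsto_measure_avoid_holds`) and the rest of the proof of Prop. 3.3
(`RestrictionExponent`) are proved in the tree. The other hypotheses are as in
`LawlerSchrammWerner2003_of_leaf_facts'''`.
[cite: LawlerSchrammWerner2003Restriction, p. 5 result 2 with Prop. 3.3, Lemma 3.5, Thm. 6.1, Thm. 7.3, Cor. 8.6] -/
theorem LawlerSchrammWerner2003_of_leaf_facts'''' (h8 : hasSLETrace_eight)
    (hne : hasSLETrace_of_ne_eight) (htr : tendsto_norm_sleTrace_atTop)
    (h₆ : RandomPlanarGeometry.ae_isSimpleTrace_sleTrace_of_le_four (κ := (8 : ℝ≥0) / 3))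
    (h61 : sle_restriction_eightThirds)
    (h35d : IsPlusHull.exists_isLSWGenerated_lswConverges)
    (h58 : IsRestrictionMeasure.eq_five_eighths_of_outer_simple) : LawlerSchrammWerner2003 :=
  LawlerSchrammWerner2003_of_leaf_facts''' h8 hne htr h₆ h61
    (exists_isRestrictionMeasure_of_isHullMultiplicative_of_lemma35
      LSWConverges.tendsto_measure_avoid_holds h35d) h58

/-- **[LSW] p. 5 result 2 (transposed) from NINE leaf facts**: as
`LawlerSchrammWerner2003_of_leaf_facts''''`, with Thm. 6.1 fed by
`sle_restriction_eightThirds_of_printed_facts` (`SLERestrictionSlidHull`) from the restriction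
martingale (`hM`, Prop. 5.2/5.3), Lemma 6.2 (`h62`) and Lemma 6.3 (`h63`), the other inputs of
that reduction being theorems of the tree (as in
`IsSLELaw.hullRestriction_eightThirds_of_leaf_facts`, `HullRestrictionSLELeaf`).
[cite: LawlerSchrammWerner2003Restriction, p. 5 result 2 with Prop. 3.3, Lemma 3.5, Prop. 5.2, Lemmas 6.2–6.3, Thm. 7.3, Cor. 8.6] -/
theorem LawlerSchrammWerner2003_of_leaf_facts''''' (h8 : hasSLETrace_eight)
    (hne : hasSLETrace_of_ne_eight) (htr : tendsto_norm_sleTrace_atTop)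
    (h₆ : RandomPlanarGeometry.ae_isSimpleTrace_sleTrace_of_le_four (κ := (8 : ℝ≥0) / 3))
    (hM : sle_exists_isRestrictionMartingale) (h62 : Loewner.restrictionDeriv_exitTime_gt)
    (h63 : IsSmoothHull.restrictionDerivVanishesAtHit)
    (h35d : IsPlusHull.exists_isLSWGenerated_lswConverges)
    (h58 : IsRestrictionMeasure.eq_five_eighths_of_outer_simple) : LawlerSchrammWerner2003 := by
  haveI : Fact Process.isProjectiveLimit_preWienerMeasure := ⟨isProjectiveLimit_preWienerMeasure_holds⟩
  have hgen : HasSLETrace ((8 : ℝ≥0) / 3) := hasSLETrace h8 hne _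
  have h61 : sle_restriction_eightThirds :=
    sle_restriction_eightThirds_of_printed_facts IsStarHull.existsUnique_isRestrictionMap_holds
      IsStarHull.exists_hasRestrictionDeriv_holds hM h62 h63
      IsPlusHull.exists_antitone_isSmoothHull_holds hgen h₆ htr
      sle_swallowingTime_ofReal_eq_firstHit_holds (aemeasurable_sleTrace_holds hgen)
  exact LawlerSchrammWerner2003_of_leaf_facts'''' h8 hne htr h₆ h61 h35d h58

end Literature.Probability.RandomPlanarGeometry

end
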